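import Literature.AlgebraicGeometry.ModuliOfAbelianVarieties.SiegelAdelicMarkingLevelReading
import Literature.AlgebraicGeometry.AbelianSchemes.AbelianSchemeSymplecticLevel
import Literature.AlgebraicGeometry.Motives.AbelianVarietyConjugate
import HarnessLib

/-!
# Level sections of marked triples are carried to level sections (`σᵢ ↦ σ″ᵢ`) by a `K_δ(N)`-compatible map on points
# ([Milne 2005] Thm. 6.11 «sending `ηK` to `η′K`»; [Deligne 1971] 4.16; [Lan 2013] Def. 1.3.6.2)

Topic `AlgebraicGeometry/ModuliOfAbelianVarieties`; namespace `Literature.AlgebraicGeometry.ModuliOfAbelianVarieties.SiegelAdelicMarking`.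
Cell hodgecm-mathlib (D-0151), rung-0 memo `B-plan/M1PRIME-DAG.md` W3 (stub prover B-p01), sub-goal **(c-iv-glue)** of the
W3 OPEN SUB-GOALS list (2026-08-29T00:53:13Z): the hypothesis
`hσ : ∀ i, AlgPoints.map h… (A′.restrictPt (𝟙 _) (φ′.σ i)) = A.restrictPt (𝟙 _) (φ.σ i)` of ★
`AbelianSchemeOver.levelStructure_isBaseChangeVia_id_of_fibreIso` (the LEVEL/X clause of the triple transport), FROM the
marking data of the rung-0 predicate `MarkedBy` (its symplectic-lift tower clause, [D3 `LevelStructure.SymplecticLift`] with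
`lift_level`) and the W3 antecedent «`f` carries `σ ∘ η` to `η′ ∘ k`, `k ∈ K_δ(N)`».  THEOREMS ONLY (no definition, no named fact,
no instance, no `sorry`); ★ T1′ / ★ R60-58 / ★ `SiegelAdelicMarkingLevelReading` / ★ D1–D3 currency.  HC_CM is proved only
modulo the printed citations until rung 0 closes.

* §1 `apply_eq_of_levelReading`, `apply_eq_of_levelReading_val` — ★ `map_eq_of_levelReading(_val)` for an ARBITRARY map
  `ψ : A(ℂ) → A′(ℂ)` on points in place of `AlgPoints.map f` (the W3 road applies it to `ψ = f_B ∘ (·)^σ`, which is not a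
  morphism of `ℂ`-varieties).
* §2 `restrictPt_level_eq_r_of_lift` — the tower clause of `MarkedBy` at `M = N` and `lift_level` READ the level section
  `σᵢ(s)` at the class `eᵢ/N` through the marking (`σᵢ(s) = u(v)` whenever `a⁻¹ v̂ ≡ eᵢ/N`).
* §3 **`apply_restrictPt_level_eq_of_lifts`** — CORE: two marked fibres with symplectic-lift towers read through `a`, `a′`
  and a map `ψ` on points with `ψ (u v) = u″ w` whenever `k a⁻¹ v̂ ≡ a′⁻¹ ŵ` (`k ∈ K_δ(N)`) ⟹ `ψ (σᵢ(s)) = σ″ᵢ(s″)` for all `i`.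
* §4 **`map_comp_restrictPt_level_eq_of_conj`** — the (c-iv-glue) shape verbatim: `ψ := f_B ∘ (·)^σ` for
  `f_B : B^σ → B″` with the ★ `StubW3` antecedent `∃ k ∈ K_δ(N), …` for the fibre markings `(m₁, m₂)`, and a morphism
  `j : A₃(s₃) → B^σ` reading `(·)^σ` on the level sections (the conjugate triple's fibre junction `jσ`) ⟹
  `AlgPoints.map (j ≫ f_B)… (σ⁽³⁾ᵢ(s₃)) = σ″ᵢ(s″)`; Iso form `…_of_hom_eq` for `h` with `h.hom = j ≫ f_B`.

## References
* [Milne2005ShimuraVarieties] J. S. Milne, *Introduction to Shimura varieties* (2005), §6 Thm. 6.11 p. 74 and p. 75 (`ηK ↦ η′K`).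
* [Deligne1971TravauxShimura] P. Deligne, *Travaux de Shimura*, Sém. Bourbaki 389 (1971), 4.12 (b) p. 149, 4.16 p. 150.
* [Lan2013PELCompactifications] K.-W. Lan, *Arithmetic compactifications of PEL-type Shimura varieties* (2013), §1.3.6
  Def. 1.3.6.2 p. 80 (symplectic-liftable level structures; the level-`N` layer is the level structure).
-/

set_option autoImplicit false

noncomputable section

open Matrix CategoryTheory AlgebraicGeometry
open Literature.AlgebraicGeometry.Motives (AbelianVariety AlgPoints CartierDivisor)
open Literature.AlgebraicGeometry.AbelianSchemes (AbelianSchemeOver)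
open Literature.NumberTheory.Adeles (latticeOfGL)

namespace Literature.AlgebraicGeometry.ModuliOfAbelianVarieties

namespace SiegelAdelicMarking

variable {g : ℕ} {δ : Fin g → ℕ}
variable {J J' : C0pm δ} {a a' k : gspFinAdelic δ}

/-! ### §1. Level readings transported by an arbitrary map on points -/

section FunctionValued

variable {A A' : AbelianVariety ℂ}

/-- **A `K_δ(N)`-compatible MAP ON POINTS carries level-`N` readings to level-`N` readings** — ★ `map_eq_of_levelReading`
with `AlgPoints.map f` replaced by an arbitrary `ψ : A(ℂ) → A′(ℂ)` (only the compatibility `ψ (u v) = u′ w` for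
`k a⁻¹ v̂ ≡ a′⁻¹ ŵ` is used): points `x`, `x′` READ at a class `c` (`N c ∈ ℤ^{2g}`) through the two markings satisfy `ψ x = x′`.
[cite: Milne2005ShimuraVarieties, §6 Thm. 6.11 p. 74 and p. 75] [cite: Deligne1971TravauxShimura, 4.16 p. 150] -/
theorem apply_eq_of_levelReading (m : SiegelAdelicMarking J a A) (m' : SiegelAdelicMarking J' a' A')
    (ψ : A.Points ℂ → A'.Points ℂ) {N : ℕ} (hk : k ∈ principalLevelSubgroup δ N)
    (hψ : ∀ v w : Fin g ⊕ Fin g → ℚ,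
      AdelicCongr ((k * a⁻¹ : gspFinAdelic δ) : GL (Fin g ⊕ Fin g) finAdeleQ)
          ((a'⁻¹ : gspFinAdelic δ) : GL (Fin g ⊕ Fin g) finAdeleQ) v w → ψ (m.r v) = m'.r w)
    {c : Fin g ⊕ Fin g → ℚ} (hc : N • c ∈ latticeOfGL (1 : GL (Fin g ⊕ Fin g) finAdeleQ))
    {x : A.Points ℂ} {x' : A'.Points ℂ}
    (hx : ∀ v, AdelicCongr ((a⁻¹ : gspFinAdelic δ) : GL (Fin g ⊕ Fin g) finAdeleQ) 1 v c → x = m.r v)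
    (hx' : ∀ w, AdelicCongr ((a'⁻¹ : gspFinAdelic δ) : GL (Fin g ⊕ Fin g) finAdeleQ) 1 w c → x' = m'.r w) :
    ψ x = x' := by
  obtain ⟨v, hv⟩ := exists_adelicCongr_left ((a⁻¹ : gspFinAdelic δ) : GL (Fin g ⊕ Fin g) finAdeleQ) 1 c
  obtain ⟨w, hvw⟩ := exists_adelicCongr_right ((k * a⁻¹ : gspFinAdelic δ) : GL (Fin g ⊕ Fin g) finAdeleQ)
    ((a'⁻¹ : gspFinAdelic δ) : GL (Fin g ⊕ Fin g) finAdeleQ) v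
  rw [hx v hv, hψ v w hvw, hx' w (adelicCongr_inv_one_of_level hk hc hv hvw)]

/-- **The same at the tower classes `c = x̃/N`, `x : (ℤ/N)^{2g}`** (the shape in which D3's `SymplecticLift` tower and the
rung-0 predicate `MarkedBy` read points). [cite: Milne2005ShimuraVarieties, §6 Thm. 6.11 p. 74 and p. 75]
[cite: Deligne1971TravauxShimura, 4.16 p. 150] -/
theorem apply_eq_of_levelReading_val (m : SiegelAdelicMarking J a A) (m' : SiegelAdelicMarking J' a' A')
    (ψ : A.Points ℂ → A'.Points ℂ) {N : ℕ} (hN : N ≠ 0) (hk : k ∈ principalLevelSubgroup δ N)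
    (hψ : ∀ v w : Fin g ⊕ Fin g → ℚ,
      AdelicCongr ((k * a⁻¹ : gspFinAdelic δ) : GL (Fin g ⊕ Fin g) finAdeleQ)
          ((a'⁻¹ : gspFinAdelic δ) : GL (Fin g ⊕ Fin g) finAdeleQ) v w → ψ (m.r v) = m'.r w)
    (x : Fin g ⊕ Fin g → ZMod N) {y : A.Points ℂ} {y' : A'.Points ℂ}
    (hy : ∀ v, AdelicCongr ((a⁻¹ : gspFinAdelic δ) : GL (Fin g ⊕ Fin g) finAdeleQ) 1 v
      (fun i => ((x i).val : ℚ) / N) → y = m.r v)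
    (hy' : ∀ w, AdelicCongr ((a'⁻¹ : gspFinAdelic δ) : GL (Fin g ⊕ Fin g) finAdeleQ) 1 w
      (fun i => ((x i).val : ℚ) / N) → y' = m'.r w) :
    ψ y = y' :=
  apply_eq_of_levelReading m m' ψ hk hψ (nsmul_val_div_mem_latticeOfGL_one hN x) hy hy'

end FunctionValued

/-! ### §2. The tower clause of `MarkedBy` reads the level sections -/

section Tower

variable {N : ℕ} {S : Scheme} {B : AbelianSchemeOver S} {s : Spec (.of ℂ) ⟶ S} {φ : B.LevelStructure g N}
  {Θ : CartierDivisor (B.fibre s).toAbelianVariety.X.left}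

/-- **The level section `σᵢ(s)` is READ at the class `eᵢ/N` by the marking**: if the symplectic-lift tower of `(φ, Θ)`
read through `a` IS the marking (`a⁻¹ v̂ ≡ x̃/M ⟹ Λ_M(x) = u(v)`, the tower clause of `MarkedBy`), then — `Λ_N(eᵢ) = σᵢ(s)`
being the `lift_level` field of [D3] — `σᵢ(s) = u(v)` whenever `a⁻¹ v̂ ≡ eᵢ/N`.
[cite: Lan2013PELCompactifications, §1.3.6 Def. 1.3.6.2 (p. 80)] [cite: Milne2005ShimuraVarieties, §6 Thm. 6.11 p. 75]
[cite: Deligne1971TravauxShimura, 4.12 (b) p. 149] -/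
theorem restrictPt_level_eq_r_of_lift (Λ : φ.SymplecticLift s Θ δ)
    (m : SiegelAdelicMarking J a (B.fibre s).toAbelianVariety) (hN : N ≠ 0)
    (hΛ : ∀ ⦃M : ℕ⦄, N ∣ M → M ≠ 0 → ∀ (x : Fin g ⊕ Fin g → ZMod M) (v : Fin g ⊕ Fin g → ℚ),
      AdelicCongr ((a⁻¹ : gspFinAdelic δ) : GL (Fin g ⊕ Fin g) finAdeleQ) 1 v (fun i => ((x i).val : ℚ) / M) →
        ((Λ.lift M (Multiplicative.ofAdd x)) : (B.fibre s).toAbelianVariety.Points ℂ) = m.r v)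
    (i : Fin g ⊕ Fin g) (v : Fin g ⊕ Fin g → ℚ)
    (hv : AdelicCongr ((a⁻¹ : gspFinAdelic δ) : GL (Fin g ⊕ Fin g) finAdeleQ) 1 v
      (fun j => (((Pi.single i (1 : ZMod N) : Fin g ⊕ Fin g → ZMod N) j).val : ℚ) / N)) :
    B.restrictPt s (φ.σ i) = m.r v := by
  rw [← Λ.lift_level i]
  exact hΛ (dvd_refl N) hN (Pi.single i 1) v hv

end Tower

/-! ### §3. CORE: a `K_δ(N)`-compatible map on points carries level sections to level sections -/

section Core

variable {N : ℕ}
variable {S₁ : Scheme} {B₁ : AbelianSchemeOver S₁} {s₁ : Spec (.of ℂ) ⟶ S₁} {φ₁ : B₁.LevelStructure g N}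
  {Θ₁ : CartierDivisor (B₁.fibre s₁).toAbelianVariety.X.left}
variable {S₂ : Scheme} {B₂ : AbelianSchemeOver S₂} {s₂ : Spec (.of ℂ) ⟶ S₂} {φ₂ : B₂.LevelStructure g N}
  {Θ₂ : CartierDivisor (B₂.fibre s₂).toAbelianVariety.X.left}

/-- **LEVEL SECTIONS GO TO LEVEL SECTIONS.**  Two fibres `B₁(s₁)`, `B₂(s₂)` of abelian schemes with level-`N` structures
`φ₁`, `φ₂`, marked by `[J, a]`, `[J′, a′]` with symplectic-lift towers read through `a`, `a′` (the `MarkedBy` clauses), and a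
map on points `ψ : B₁(s₁)(ℂ) → B₂(s₂)(ℂ)` with `ψ (u₁ v) = u₂ w` whenever `k a⁻¹ v̂ ≡ a′⁻¹ ŵ` for a fixed `k ∈ K_δ(N)`:
then `ψ (σ₁ᵢ(s₁)) = σ₂ᵢ(s₂)` for every `i` («sending `ηK` to `η′K`», read on the bases).
[cite: Milne2005ShimuraVarieties, §6 Thm. 6.11 p. 74 and p. 75] [cite: Deligne1971TravauxShimura, 4.16 p. 150]
[cite: Lan2013PELCompactifications, §1.3.6 Def. 1.3.6.2 (p. 80)] -/
theorem apply_restrictPt_level_eq_of_lifts (hN : N ≠ 0) (hk : k ∈ principalLevelSubgroup δ N)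
    (Λ₁ : φ₁.SymplecticLift s₁ Θ₁ δ) (m₁ : SiegelAdelicMarking J a (B₁.fibre s₁).toAbelianVariety)
    (hΛ₁ : ∀ ⦃M : ℕ⦄, N ∣ M → M ≠ 0 → ∀ (x : Fin g ⊕ Fin g → ZMod M) (v : Fin g ⊕ Fin g → ℚ),
      AdelicCongr ((a⁻¹ : gspFinAdelic δ) : GL (Fin g ⊕ Fin g) finAdeleQ) 1 v (fun i => ((x i).val : ℚ) / M) →
        ((Λ₁.lift M (Multiplicative.ofAdd x)) : (B₁.fibre s₁).toAbelianVariety.Points ℂ) = m₁.r v)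
    (Λ₂ : φ₂.SymplecticLift s₂ Θ₂ δ) (m₂ : SiegelAdelicMarking J' a' (B₂.fibre s₂).toAbelianVariety)
    (hΛ₂ : ∀ ⦃M : ℕ⦄, N ∣ M → M ≠ 0 → ∀ (x : Fin g ⊕ Fin g → ZMod M) (v : Fin g ⊕ Fin g → ℚ),
      AdelicCongr ((a'⁻¹ : gspFinAdelic δ) : GL (Fin g ⊕ Fin g) finAdeleQ) 1 v (fun i => ((x i).val : ℚ) / M) →
        ((Λ₂.lift M (Multiplicative.ofAdd x)) : (B₂.fibre s₂).toAbelianVariety.Points ℂ) = m₂.r v)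
    (ψ : (B₁.fibre s₁).toAbelianVariety.Points ℂ → (B₂.fibre s₂).toAbelianVariety.Points ℂ)
    (hψ : ∀ v w : Fin g ⊕ Fin g → ℚ,
      AdelicCongr ((k * a⁻¹ : gspFinAdelic δ) : GL (Fin g ⊕ Fin g) finAdeleQ)
          ((a'⁻¹ : gspFinAdelic δ) : GL (Fin g ⊕ Fin g) finAdeleQ) v w → ψ (m₁.r v) = m₂.r w)
    (i : Fin g ⊕ Fin g) :
    ψ (B₁.restrictPt s₁ (φ₁.σ i)) = B₂.restrictPt s₂ (φ₂.σ i) :=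
  apply_eq_of_levelReading_val m₁ m₂ ψ hN hk hψ (Pi.single i 1)
    (fun v hv => restrictPt_level_eq_r_of_lift Λ₁ m₁ hN hΛ₁ i v hv)
    (fun w hw => restrictPt_level_eq_r_of_lift Λ₂ m₂ hN hΛ₂ i w hw)

/-! ### §4. The (c-iv-glue) shape: `ψ = f_B ∘ (·)^σ`, precomposed with the conjugate fibre's junction `j` -/

variable {S₃ : Scheme} {B₃ : AbelianSchemeOver S₃} {s₃ : Spec (.of ℂ) ⟶ S₃}

/-- **(c-iv-glue).**  In the W3 road: `B := B₁(s₁)` the fibre of the `(J, a)`-marked triple, `B″ := B₂(s₂)` that of the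
`(J′, a′)`-marked one (markings `m₁`, `m₂` and towers from `MarkedBy`), `τ` an automorphism of `ℂ`,
`f : B^τ → B″` with the ★ `StubW3` antecedent «`∃ k ∈ K_δ(N)`, `f ((u₁ v)^τ) = u₂ w` whenever `k a⁻¹ v̂ ≡ a′⁻¹ ŵ`» (for the
fibre markings — the (W3-J) glue), and `j : B₃(s₃) → B^τ` the junction of the conjugate triple's fibre, reading `(·)^τ` on the
level sections.  THEN `j ≫ f` carries `σ⁽³⁾ᵢ(s₃)` to `σ″ᵢ(s₂)` for every `i` — the hypothesis `hσ` of ★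
`AbelianSchemeOver.levelStructure_isBaseChangeVia_id_of_fibreIso` for `h` with `h.hom = j ≫ f`.
[cite: Milne2005ShimuraVarieties, §6 Thm. 6.11 p. 74 and p. 75, §14 Prop. 14.12 p. 125]
[cite: Deligne1971TravauxShimura, 4.16 p. 150] -/
theorem map_comp_restrictPt_level_eq_of_conj (hN : N ≠ 0) (τ : ℂ ≃+* ℂ)
    (Λ₁ : φ₁.SymplecticLift s₁ Θ₁ δ) (m₁ : SiegelAdelicMarking J a (B₁.fibre s₁).toAbelianVariety)
    (hΛ₁ : ∀ ⦃M : ℕ⦄, N ∣ M → M ≠ 0 → ∀ (x : Fin g ⊕ Fin g → ZMod M) (v : Fin g ⊕ Fin g → ℚ),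
      AdelicCongr ((a⁻¹ : gspFinAdelic δ) : GL (Fin g ⊕ Fin g) finAdeleQ) 1 v (fun i => ((x i).val : ℚ) / M) →
        ((Λ₁.lift M (Multiplicative.ofAdd x)) : (B₁.fibre s₁).toAbelianVariety.Points ℂ) = m₁.r v)
    (Λ₂ : φ₂.SymplecticLift s₂ Θ₂ δ) (m₂ : SiegelAdelicMarking J' a' (B₂.fibre s₂).toAbelianVariety)
    (hΛ₂ : ∀ ⦃M : ℕ⦄, N ∣ M → M ≠ 0 → ∀ (x : Fin g ⊕ Fin g → ZMod M) (v : Fin g ⊕ Fin g → ℚ),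
      AdelicCongr ((a'⁻¹ : gspFinAdelic δ) : GL (Fin g ⊕ Fin g) finAdeleQ) 1 v (fun i => ((x i).val : ℚ) / M) →
        ((Λ₂.lift M (Multiplicative.ofAdd x)) : (B₂.fibre s₂).toAbelianVariety.Points ℂ) = m₂.r v)
    (f : ((B₁.fibre s₁).toAbelianVariety).conjugate τ ⟶ (B₂.fibre s₂).toAbelianVariety)
    (hf : ∃ k ∈ principalLevelSubgroup δ N, ∀ v w : Fin g ⊕ Fin g → ℚ,
      AdelicCongr ((k * a⁻¹ : gspFinAdelic δ) : GL (Fin g ⊕ Fin g) finAdeleQ)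
          ((a'⁻¹ : gspFinAdelic δ) : GL (Fin g ⊕ Fin g) finAdeleQ) v w →
        AlgPoints.map f.hom.hom.hom ((B₁.fibre s₁).toAbelianVariety.conjPoints τ (m₁.r v)) = m₂.r w)
    (φ₃ : B₃.LevelStructure g N) (j : (B₃.fibre s₃).toAbelianVariety ⟶ ((B₁.fibre s₁).toAbelianVariety).conjugate τ)
    (hj : ∀ i, AlgPoints.map j.hom.hom.hom (B₃.restrictPt s₃ (φ₃.σ i)) =
      (B₁.fibre s₁).toAbelianVariety.conjPoints τ (B₁.restrictPt s₁ (φ₁.σ i)))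
    (i : Fin g ⊕ Fin g) :
    AlgPoints.map (j ≫ f).hom.hom.hom (B₃.restrictPt s₃ (φ₃.σ i)) = B₂.restrictPt s₂ (φ₂.σ i) := by
  obtain ⟨k, hk, hf⟩ := hf
  have e : (j ≫ f).hom.hom.hom = j.hom.hom.hom ≫ f.hom.hom.hom := rfl
  rw [e, AlgPoints.map_comp_apply, hj i]
  exact apply_restrictPt_level_eq_of_lifts hN hk Λ₁ m₁ hΛ₁ Λ₂ m₂ hΛ₂
    (fun P => AlgPoints.map f.hom.hom.hom ((B₁.fibre s₁).toAbelianVariety.conjPoints τ P)) hf i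

/-- **(c-iv-glue), Iso form**: the same for an isomorphism `h : B₃(s₃) ≅ B″` of the fibres with `h.hom = j ≫ f` (e.g.
`h := jσ ≪≫ asIso f_B`) — LITERALLY the hypothesis `hσ` of ★ `AbelianSchemeOver.levelStructure_isBaseChangeVia_id_of_fibreIso`
at `s₃ = s₂ = 𝟙 (Spec ℂ)`. [cite: Milne2005ShimuraVarieties, §6 Thm. 6.11 p. 74 and p. 75, §14 Prop. 14.12 p. 125]
[cite: Deligne1971TravauxShimura, 4.16 p. 150] -/
theorem map_restrictPt_level_eq_of_conj_of_hom_eq (hN : N ≠ 0) (τ : ℂ ≃+* ℂ)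
    (Λ₁ : φ₁.SymplecticLift s₁ Θ₁ δ) (m₁ : SiegelAdelicMarking J a (B₁.fibre s₁).toAbelianVariety)
    (hΛ₁ : ∀ ⦃M : ℕ⦄, N ∣ M → M ≠ 0 → ∀ (x : Fin g ⊕ Fin g → ZMod M) (v : Fin g ⊕ Fin g → ℚ),
      AdelicCongr ((a⁻¹ : gspFinAdelic δ) : GL (Fin g ⊕ Fin g) finAdeleQ) 1 v (fun i => ((x i).val : ℚ) / M) →
        ((Λ₁.lift M (Multiplicative.ofAdd x)) : (B₁.fibre s₁).toAbelianVariety.Points ℂ) = m₁.r v)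
    (Λ₂ : φ₂.SymplecticLift s₂ Θ₂ δ) (m₂ : SiegelAdelicMarking J' a' (B₂.fibre s₂).toAbelianVariety)
    (hΛ₂ : ∀ ⦃M : ℕ⦄, N ∣ M → M ≠ 0 → ∀ (x : Fin g ⊕ Fin g → ZMod M) (v : Fin g ⊕ Fin g → ℚ),
      AdelicCongr ((a'⁻¹ : gspFinAdelic δ) : GL (Fin g ⊕ Fin g) finAdeleQ) 1 v (fun i => ((x i).val : ℚ) / M) →
        ((Λ₂.lift M (Multiplicative.ofAdd x)) : (B₂.fibre s₂).toAbelianVariety.Points ℂ) = m₂.r v)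
    (f : ((B₁.fibre s₁).toAbelianVariety).conjugate τ ⟶ (B₂.fibre s₂).toAbelianVariety)
    (hf : ∃ k ∈ principalLevelSubgroup δ N, ∀ v w : Fin g ⊕ Fin g → ℚ,
      AdelicCongr ((k * a⁻¹ : gspFinAdelic δ) : GL (Fin g ⊕ Fin g) finAdeleQ)
          ((a'⁻¹ : gspFinAdelic δ) : GL (Fin g ⊕ Fin g) finAdeleQ) v w →
        AlgPoints.map f.hom.hom.hom ((B₁.fibre s₁).toAbelianVariety.conjPoints τ (m₁.r v)) = m₂.r w)
    (φ₃ : B₃.LevelStructure g N) (j : (B₃.fibre s₃).toAbelianVariety ⟶ ((B₁.fibre s₁).toAbelianVariety).conjugate τ)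
    (hj : ∀ i, AlgPoints.map j.hom.hom.hom (B₃.restrictPt s₃ (φ₃.σ i)) =
      (B₁.fibre s₁).toAbelianVariety.conjPoints τ (B₁.restrictPt s₁ (φ₁.σ i)))
    (h : (B₃.fibre s₃).toAbelianVariety ≅ (B₂.fibre s₂).toAbelianVariety) (hh : h.hom = j ≫ f)
    (i : Fin g ⊕ Fin g) :
    AlgPoints.map h.hom.hom.hom.hom (B₃.restrictPt s₃ (φ₃.σ i)) = B₂.restrictPt s₂ (φ₂.σ i) := by
  rw [hh]
  exact map_comp_restrictPt_level_eq_of_conj hN τ Λ₁ m₁ hΛ₁ Λ₂ m₂ hΛ₂ f hf φ₃ j hj i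

end Core

end SiegelAdelicMarking

end Literature.AlgebraicGeometry.ModuliOfAbelianVarieties

end
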